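import Literature.AnabelianGeometry.SemiGraphs.TemperedCompactInVerticialAtBridge
import Literature.AnabelianGeometry.SemiGraphs.TemperedMaximalCompactProofsAt
import Literature.AnabelianGeometry.SemiGraphs.TemperedEdgeLikeDistinctOfAt
import Literature.AnabelianGeometry.SemiGraphs.TemperedVerticialNamedFactsProofs
import HarnessLib

/-!
# [SemiAnbd] Thm 3.7 (iv), the rung-4 residual and `EdgeLikeDistinct` from Thm 3.7 (iii) ALONE — PER-GRAPH
twin (cell ruling φ2 / α4-3 (ii))

Mochizuki, *Semi-graphs of anabelioids*, Publ. RIMS **42** (2006), §3, Theorem 3.7 (ii)–(iv), manuscript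
pp. 40–41 [cite: MochizukiSemiAnbd2006, Thm 3.7(iii)(iv) pp.40-41].

PROOF-ONLY companion of `TemperedThm37OfCompactInVerticial.lean` (abc-iut cell wave-4 seat abc-iut-w4-d075,
L3-lead ruling α4-3 (ii)
«φ2-CONSUMERS»): the same theorems with the ∀-countable named facts `CompactInVerticial` /
`MaximalCompactIffVerticial` / `EdgeLikeIsInfVerticial` / `EdgeLikeDistinct` replaced by their per-graph
forms `…At 𝒢` (`TemperedCompactInVerticialAt.lean`), so that the finite-`𝔾` producer
(`compactInVerticialAt_of_finiteLevelData`) feeds them; proofs ported VERBATIM with `hCV 𝒢 ↦ hCV`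
(the `Thm37Hypotheses` argument stays).  Original file untouched.  No definitions, no new named fact;
nothing here asserts Thm 3.7 (iii) for an infinite `𝔾`, and nothing bears on [IUTchIII] Cor. 3.12.
-/

namespace Literature.AnabelianGeometry.SemiGraphs

namespace ProfiniteSemiGraph

open Topology

universe u w

variable {𝒢 ℋ : ProfiniteSemiGraph.{u}}

/-- **Thm 3.7 (iv) at `𝒢` from Thm 3.7 (iii) at `𝒢`** ((i), (ii) discharged in the tree).
[cite: MochizukiSemiAnbd2006, Thm 3.7(iv) p.41] -/
theorem maximalCompactIffVerticialAt_of_compactInVerticialAt (hCV : CompactInVerticialAt 𝒢) :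
    MaximalCompactIffVerticialAt 𝒢 :=
  maximalCompactIffVerticialAt_of_thm37 hCV verticialDistinct_holds verticialInjective_holds

/-- **`EdgeLikeIsInfVerticial` at `𝒢` from Thm 3.7 (iii) at `𝒢`** ((i), (ii) discharged in the tree).
[cite: MochizukiSemiAnbd2006, Thm 3.7(iv) p.41] -/
theorem edgeLikeIsInfVerticialAt_of_compactInVerticialAt (hCV : CompactInVerticialAt 𝒢) :
    EdgeLikeIsInfVerticialAt 𝒢 :=
  edgeLikeIsInfVerticialAt_of hCV verticialDistinct_holds verticialInjective_holds

/-- **`EdgeLikeDistinct` at `𝒢` from Thm 3.7 (iii) at `𝒢`** ((i), (ii) discharged in the tree).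
[cite: MochizukiSemiAnbd2006, Thm 3.7(iv) p.41] -/
theorem edgeLikeDistinctAt_of_compactInVerticialAt (hCV : CompactInVerticialAt 𝒢) : EdgeLikeDistinctAt 𝒢 :=
  edgeLikeDistinctAt_of hCV verticialDistinct_holds verticialInjective_holds

/-- **The three at every FINITE `𝒢`, from the producer statement for finite `𝒢`** (φ2 finite twins of
Thm 3.7 (iv), of the rung-4 residual and of `EdgeLikeDistinct`). [cite: MochizukiSemiAnbd2006, Thm 3.7(iv) p.41] -/
theorem maximalCompactIffVerticialAt_of_finite
    (hDfin : ∀ (𝒢 : ProfiniteSemiGraph.{u}), 𝒢.Thm37Hypotheses → Finite 𝒢.graph.Vertex →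
      Finite 𝒢.graph.Edge → ∃ c₀ : TemperedPiChart 𝒢, Nonempty (FiniteLevelData.{w} 𝒢 c₀))
    (hV : Finite 𝒢.graph.Vertex) (hE : Finite 𝒢.graph.Edge) :
    MaximalCompactIffVerticialAt 𝒢 ∧ EdgeLikeIsInfVerticialAt 𝒢 ∧ EdgeLikeDistinctAt 𝒢 :=
  ⟨maximalCompactIffVerticialAt_of_compactInVerticialAt (compactInVerticialAt_of_finite hDfin hV hE),
    edgeLikeIsInfVerticialAt_of_compactInVerticialAt (compactInVerticialAt_of_finite hDfin hV hE),
    edgeLikeDistinctAt_of_compactInVerticialAt (compactInVerticialAt_of_finite hDfin hV hE)⟩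

end ProfiniteSemiGraph

end Literature.AnabelianGeometry.SemiGraphs
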